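import Mathlib
import Summits.Ventures.HodgeRepro.Tier4.Line4.WallDataOfIntegers

/-!
# Tier4/Line4/WallDataOfIntegersClosed — part 10 with L4-p2's two consumer obligations discharged BY NAME
(C-L4-B-EXTEND, part 11)

Blind re-derivation cell `pub-hodge-repro`, Tier 4 «prove the step» (README §9–§10), seat t4-x2 (reserve
wall-breaker, gen 6; GO S16576).  Tree path `lean/Summits/Ventures/HodgeRepro/Tier4/Line4/WallDataOfIntegersClosed.lean`.
Imports: Mathlib + `Tier4/Line4/WallDataOfIntegers` (the chain parts 1–10; through it L4-p2's TorusArchClosed p723452: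
`isClosed_rationalOf_torusT`, `rationalOf_inf_torusInf_eq_bot`).  No definition, no instance, no printed theorem proved.

* **`exists_rtfData_of_integers_seesaw_closed`** — `exists_rtfData_of_integers_seesaw` without the binders `[hcl]` and
  `hbot` (they were binders only by the olean-lag convention of parts 1–3a; p723452 discharges both): the wall's
  `R _hR _hunit' _hchi _hchi' compT compT' hc hu hc'` from the integers modulo the print [DE14] Cor. 3.6.2 (`hDE`,
  `hDE'`), the N2 relation `hsum` and the general position `hgen` ONLY.
Nothing here says anything about the status of the Hodge conjecture for CM abelian varieties, which is NOT proved;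
HC_CM is NOT proved by anyone in this repository.
-/

set_option autoImplicit false

noncomputable section

namespace Summit.Ventures.HodgeRepro.Tier4.Line4

open NumberField Matrix MeasureTheory Summit.Ventures.HodgeRepro.Tier4.Common
  Summit.Ventures.HodgeRepro.Tier4.Line1 Summit.Ventures.HodgeRepro.Tier4.Lit

section WallDataClosed

variable {k : Type} [Field k] [NumberField k] (q : QuadData k) (a : Fin 4 → k)
  (g g' : Matrix (Fin 4) (Fin 4) k) (hgg' : g * g' = 1) (hg'g : g' * g = 1)
  (hgΩ : g * (PlaneData.mixedRow q (a 0) (a 2)).Ω = (PlaneData.mixedRow q (a 0) (a 2)).Ω * g)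
  (lam : k) (hlam : lam ≠ 0)
  (hiso : g * (PlaneData.mixedRow q (a 1) (a 3)).B * gᵀ = lam • (PlaneData.mixedRow q (a 0) (a 2)).B)

include lam hlam hiso in
/-- **THE WALL'S TORUS DATA FROM THE INTEGERS, `hcl`/`hbot` DISCHARGED BY NAME** (L4-p2's p723452
`isClosed_rationalOf_torusT` / `rationalOf_inf_torusInf_eq_bot`): `R : RTFData` on the seesaw plane with Haar torus
measures, measurable relatively compact fundamental domains, and characters with the wall's `_hunit'`, `_hchi`,
`_hchi'`, `hc`, `hu`, `hc'` — from `(eP, eM, eP′, eM′)` with `hsum`, modulo the print (twice) and `hgen` ONLY. -/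
theorem exists_rtfData_of_integers_seesaw_closed
    [MeasurableSpace (GA ((PlaneData.mixedRow q (a 0) (a 2)).withTransportedTorus g g' hgg' hg'g hgΩ))]
    [BorelSpace (GA ((PlaneData.mixedRow q (a 0) (a 2)).withTransportedTorus g g' hgg' hg'g hgΩ))]
    (ht : q.t = 0) (hn : ¬ IsSquare (-q.n)) (ha : ∀ i, a i ≠ 0)
    (hreal : ∀ w : InfinitePlace k, w.IsReal) (hcm : ∀ w, IsCMAt q w)
    (hA : IsAnisotropic ((PlaneData.mixedRow q (a 0) (a 2)).withTransportedTorus g g' hgg' hg'g hgΩ))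
    (hDE : letI : CommGroup (torusT ((PlaneData.mixedRow q (a 0) (a 2)).withTransportedTorus g g' hgg' hg'g hgΩ)) :=
        { (inferInstance : Group (torusT ((PlaneData.mixedRow q (a 0) (a 2)).withTransportedTorus g g' hgg' hg'g hgΩ)))
          with mul_comm := torusT_seesaw_mul_comm q a g g' hgg' hg'g hgΩ (ha 0) (ha 2) }
      haveI : IsClosed ((rationalOf ((PlaneData.mixedRow q (a 0) (a 2)).withTransportedTorus g g' hgg' hg'g hgΩ)
          (torusT ((PlaneData.mixedRow q (a 0) (a 2)).withTransportedTorus g g' hgg' hg'g hgΩ)) :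
          Subgroup (torusT ((PlaneData.mixedRow q (a 0) (a 2)).withTransportedTorus g g' hgg' hg'g hgΩ))) :
          Set (torusT ((PlaneData.mixedRow q (a 0) (a 2)).withTransportedTorus g g' hgg' hg'g hgΩ))) :=
        isClosed_rationalOf_torusT _
      haveI : CompactSpace (torusT ((PlaneData.mixedRow q (a 0) (a 2)).withTransportedTorus g g' hgg' hg'g hgΩ) ⧸
          rationalOf ((PlaneData.mixedRow q (a 0) (a 2)).withTransportedTorus g g' hgg' hg'g hgΩ)
            (torusT ((PlaneData.mixedRow q (a 0) (a 2)).withTransportedTorus g g' hgg' hg'g hgΩ))) :=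
        compactSpace_quotient_of_cocompact _ (cocompact_rationalOf_torusT_of_anisotropic _
          (isGenuineRow_seesawPlane q ht hn a (ha 0) (ha 2) g g' hgg' hg'g hgΩ lam hlam hiso) hA)
      DeitmarEchterhoff2014_Cor_3_6_2_restriction_surjective
        (torusT ((PlaneData.mixedRow q (a 0) (a 2)).withTransportedTorus g g' hgg' hg'g hgΩ) ⧸
          rationalOf ((PlaneData.mixedRow q (a 0) (a 2)).withTransportedTorus g g' hgg' hg'g hgΩ)
            (torusT ((PlaneData.mixedRow q (a 0) (a 2)).withTransportedTorus g g' hgg' hg'g hgΩ))))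
    (hDE' : letI : CommGroup (torusT' ((PlaneData.mixedRow q (a 0) (a 2)).withTransportedTorus g g' hgg' hg'g hgΩ)) :=
        { (inferInstance : Group (torusT' ((PlaneData.mixedRow q (a 0) (a 2)).withTransportedTorus g g' hgg' hg'g hgΩ)))
          with mul_comm := torusT'_seesaw_mul_comm q a g g' hgg' hg'g hgΩ lam hlam hiso (ha 1) (ha 3) }
      haveI : IsClosed ((rationalOf ((PlaneData.mixedRow q (a 0) (a 2)).withTransportedTorus g g' hgg' hg'g hgΩ)
          (torusT' ((PlaneData.mixedRow q (a 0) (a 2)).withTransportedTorus g g' hgg' hg'g hgΩ)) :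
          Subgroup (torusT' ((PlaneData.mixedRow q (a 0) (a 2)).withTransportedTorus g g' hgg' hg'g hgΩ))) :
          Set (torusT' ((PlaneData.mixedRow q (a 0) (a 2)).withTransportedTorus g g' hgg' hg'g hgΩ))) :=
        isClosed_rationalOf_torusT' _
      haveI : CompactSpace (torusT' ((PlaneData.mixedRow q (a 0) (a 2)).withTransportedTorus g g' hgg' hg'g hgΩ) ⧸
          rationalOf ((PlaneData.mixedRow q (a 0) (a 2)).withTransportedTorus g g' hgg' hg'g hgΩ)
            (torusT' ((PlaneData.mixedRow q (a 0) (a 2)).withTransportedTorus g g' hgg' hg'g hgΩ))) :=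
        compactSpace_quotient_of_cocompact _ (cocompact_rationalOf_torusT'_of_anisotropic _
          (isGenuineRow_seesawPlane q ht hn a (ha 0) (ha 2) g g' hgg' hg'g hgΩ lam hlam hiso) hA)
      DeitmarEchterhoff2014_Cor_3_6_2_restriction_surjective
        (torusT' ((PlaneData.mixedRow q (a 0) (a 2)).withTransportedTorus g g' hgg' hg'g hgΩ) ⧸
          rationalOf ((PlaneData.mixedRow q (a 0) (a 2)).withTransportedTorus g g' hgg' hg'g hgΩ)
            (torusT' ((PlaneData.mixedRow q (a 0) (a 2)).withTransportedTorus g g' hgg' hg'g hgΩ))))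
    (eP eM eP' eM' : InfinitePlace k → ℤ) (hsum : ∀ w, eP w + eM w = eP' w + eM' w)
    (hgen : ∀ t : GA ((PlaneData.mixedRow q (a 0) (a 2)).withTransportedTorus g g' hgg' hg'g hgΩ),
      t ∈ torusT ((PlaneData.mixedRow q (a 0) (a 2)).withTransportedTorus g g' hgg' hg'g hgΩ) →
      t ∈ torusT' ((PlaneData.mixedRow q (a 0) (a 2)).withTransportedTorus g g' hgg' hg'g hgΩ) →
      t ∈ infinitePart ((PlaneData.mixedRow q (a 0) (a 2)).withTransportedTorus g g' hgg' hg'g hgΩ) →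
      t ∈ centre ((PlaneData.mixedRow q (a 0) (a 2)).withTransportedTorus g g' hgg' hg'g hgΩ)) :
    ∃ R : RTFData ((PlaneData.mixedRow q (a 0) (a 2)).withTransportedTorus g g' hgg' hg'g hgΩ),
      R.IsHaar ∧ MeasurableSet R.DT ∧ MeasurableSet R.DT' ∧ IsCompact (closure R.DT) ∧ IsCompact (closure R.DT') ∧
      (∀ t, ‖R.chi' t‖ = 1) ∧
      (∀ w : InfinitePlace k, ChiMatchesAt ((PlaneData.mixedRow q (a 0) (a 2)).withTransportedTorus g g' hgg' hg'g hgΩ)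
        q w (eP w) (eM w) R.chi) ∧
      (∀ w : InfinitePlace k, ChiMatchesAt' ((PlaneData.mixedRow q (a 0) (a 2)).withTransportedTorus g g' hgg' hg'g hgΩ)
        q w g g' (eP' w) (eM' w) R.chi') ∧
      Continuous R.chi ∧ (∀ t, ‖R.chi t‖ = 1) ∧ Continuous R.chi' := by
  haveI : IsClosed ((rationalOf ((PlaneData.mixedRow q (a 0) (a 2)).withTransportedTorus g g' hgg' hg'g hgΩ)
      (torusT ((PlaneData.mixedRow q (a 0) (a 2)).withTransportedTorus g g' hgg' hg'g hgΩ)) :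
      Subgroup (torusT ((PlaneData.mixedRow q (a 0) (a 2)).withTransportedTorus g g' hgg' hg'g hgΩ))) :
      Set (torusT ((PlaneData.mixedRow q (a 0) (a 2)).withTransportedTorus g g' hgg' hg'g hgΩ))) :=
    isClosed_rationalOf_torusT _
  exact exists_rtfData_of_integers_seesaw q a g g' hgg' hg'g hgΩ lam hlam hiso ht hn ha hreal hcm hA
    (rationalOf_inf_torusInf_eq_bot _) hDE hDE' eP eM eP' eM' hsum hgen

end WallDataClosed

end Summit.Ventures.HodgeRepro.Tier4.Line4

end
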